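import Literature.Analysis.FunctionSpaces.BesselMoments
import Mathlib.Analysis.SpecialFunctions.Integrals.Basic
import HarnessLib

/-!
# The three-term recurrence of the modified Bessel functions: `I_{n}(x) − I_{n+2}(x) = (2(n+1)/x) I_{n+1}(x)`

Topic `Literature/Analysis/FunctionSpaces`, a proofs sibling of `BesselMoments.lean` (the tree's
`besselI n x = π⁻¹ ∫₀^π e^{x cos θ} cos(nθ) dθ`, DLMF 10.32.3).  Everything is proved; no definition
and no named fact is introduced.

* **`mul_besselI_sub_besselI_add_two`** — DLMF 10.29.1 (first relation) for integer order, in the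
  division-free form `x · (I_n(x) − I_{n+2}(x)) = 2(n+1) · I_{n+1}(x)` (all real `x`, `n ∈ ℕ`):
  `cos nθ − cos(n+2)θ = 2 sin θ sin((n+1)θ)` and ONE integration by parts,
  `d/dθ [e^{x cos θ} sin((n+1)θ)] = −x sin θ sin((n+1)θ) e^{x cos θ} + (n+1) cos((n+1)θ) e^{x cos θ}`,
  whose integral over `[0, π]` vanishes.

This is the identity behind the closed form of the SU(2) character coefficients of the Wilson
weight, `I_{2j}(β) − I_{2j+2}(β) = 2(2j+1) I_{2j+1}(β)/β` (venture `LatticeQCDFlow`, exact 2-d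
oracle).  NOT here: the derivative relation `I_n' = (I_{n−1} + I_{n+1})/2` (DLMF 10.29.1, second
relation), non-integer order.

## References

* NIST DLMF §10.29.1. [`DLMF`]
-/

noncomputable section

open Real MeasureTheory intervalIntegral

namespace Literature.Analysis.FunctionSpaces

/-- `∫₀^π e^{x cos θ} cos(nθ) dθ = π I_n(x)` (the defining integral). [cite: DLMF, 10.32.3] -/
theorem integral_exp_mul_cos_mul_cos_nat (n : ℕ) (x : ℝ) :
    ∫ θ in (0 : ℝ)..π, Real.exp (x * Real.cos θ) * Real.cos (n * θ) = π * besselI n x := by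
  rw [besselI, ← mul_assoc, mul_inv_cancel₀ Real.pi_ne_zero, one_mul]

/-- The integration by parts: `d/dθ [e^{x cos θ} sin((n+1)θ)]
= −x sin θ sin((n+1)θ) e^{x cos θ} + (n+1) cos((n+1)θ) e^{x cos θ}`. [cite: DLMF, 10.29.1] -/
private theorem hasDerivAt_exp_cos_mul_sin (n : ℕ) (x θ : ℝ) :
    HasDerivAt (fun t => Real.exp (x * Real.cos t) * Real.sin ((n + 1) * t))
      (-(x * Real.sin θ * Real.sin ((n + 1) * θ) * Real.exp (x * Real.cos θ)) +
        (n + 1) * Real.cos ((n + 1) * θ) * Real.exp (x * Real.cos θ)) θ := by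
  have h1 : HasDerivAt (fun t => x * Real.cos t) (x * (-Real.sin θ)) θ :=
    (Real.hasDerivAt_cos θ).const_mul x
  have h2 : HasDerivAt (fun t => Real.exp (x * Real.cos t))
      (Real.exp (x * Real.cos θ) * (x * (-Real.sin θ))) θ := h1.exp
  have h3 : HasDerivAt (fun t => ((n : ℝ) + 1) * t) ((n : ℝ) + 1) θ := by
    simpa using (hasDerivAt_id θ).const_mul ((n : ℝ) + 1)
  have h4 : HasDerivAt (fun t => Real.sin (((n : ℝ) + 1) * t))
      (Real.cos (((n : ℝ) + 1) * θ) * ((n : ℝ) + 1)) θ := h3.sin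
  have h : HasDerivAt (fun t => Real.exp (x * Real.cos t) * Real.sin (((n : ℝ) + 1) * t))
      (Real.exp (x * Real.cos θ) * (x * (-Real.sin θ)) * Real.sin (((n : ℝ) + 1) * θ) +
        Real.exp (x * Real.cos θ) * (Real.cos (((n : ℝ) + 1) * θ) * ((n : ℝ) + 1))) θ := h2.mul h4
  exact h.congr_deriv (by ring)

/-- `∫₀^π x sin θ sin((n+1)θ) e^{x cos θ} dθ = (n+1) π I_{n+1}(x)` (the boundary term
`[e^{x cos θ} sin((n+1)θ)]₀^π` vanishes). [cite: DLMF, 10.29.1] -/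
theorem integral_mul_sin_mul_sin_mul_exp (n : ℕ) (x : ℝ) :
    ∫ θ in (0 : ℝ)..π, x * Real.sin θ * Real.sin ((n + 1) * θ) * Real.exp (x * Real.cos θ) =
      (n + 1) * (π * besselI (n + 1) x) := by
  have hc1 : Continuous fun θ : ℝ =>
      -(x * Real.sin θ * Real.sin ((n + 1) * θ) * Real.exp (x * Real.cos θ)) := by fun_prop
  have hc2 : Continuous fun θ : ℝ => (n + 1) * Real.cos ((n + 1) * θ) * Real.exp (x * Real.cos θ) := by
    fun_prop
  have hparts := integral_eq_sub_of_hasDerivAt (a := 0) (b := π)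
    (fun θ _ => hasDerivAt_exp_cos_mul_sin n x θ) ((hc1.add hc2).intervalIntegrable _ _)
  rw [intervalIntegral.integral_add (hc1.intervalIntegrable _ _) (hc2.intervalIntegrable _ _),
    intervalIntegral.integral_neg] at hparts
  have hI : ∫ θ in (0 : ℝ)..π, (n + 1) * Real.cos ((n + 1) * θ) * Real.exp (x * Real.cos θ) =
      (n + 1) * (π * besselI (n + 1) x) := by
    rw [← integral_exp_mul_cos_mul_cos_nat (n + 1) x, ← intervalIntegral.integral_const_mul]
    refine intervalIntegral.integral_congr fun θ _ => ?_
    push_cast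
    ring
  have hb : Real.sin (((n : ℝ) + 1) * π) = 0 := by
    rw [show ((n : ℝ) + 1) * π = ((n + 1 : ℕ) : ℝ) * π by push_cast; ring, Real.sin_nat_mul_pi]
  simp only [mul_zero, Real.sin_zero, hb, sub_self] at hparts
  linarith

/-- **The recurrence of the modified Bessel functions** (DLMF 10.29.1, integer order, division-free
form): `x · (I_n(x) − I_{n+2}(x)) = 2(n+1) · I_{n+1}(x)` for every real `x` and `n ∈ ℕ`.
[cite: DLMF, 10.29.1] -/
theorem mul_besselI_sub_besselI_add_two (n : ℕ) (x : ℝ) :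
    x * (besselI n x - besselI (n + 2) x) = 2 * (n + 1) * besselI (n + 1) x := by
  have hπ : (π : ℝ) ≠ 0 := Real.pi_ne_zero
  -- `π x (I_n − I_{n+2}) = x ∫ e^{x cos θ} (cos nθ − cos (n+2)θ) = ∫ 2 x sin θ sin((n+1)θ) e^{x cos θ}`
  have hc : ∀ m : ℕ, Continuous fun θ : ℝ => Real.exp (x * Real.cos θ) * Real.cos (m * θ) := fun m => by
    fun_prop
  have hdiff : π * (x * (besselI n x - besselI (n + 2) x)) =
      2 * ∫ θ in (0 : ℝ)..π, x * Real.sin θ * Real.sin ((n + 1) * θ) * Real.exp (x * Real.cos θ) := by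
    rw [mul_sub, mul_sub, mul_left_comm π x, mul_left_comm π x, ← integral_exp_mul_cos_mul_cos_nat,
      ← integral_exp_mul_cos_mul_cos_nat, ← mul_sub,
      ← intervalIntegral.integral_sub ((hc n).intervalIntegrable _ _) ((hc (n + 2)).intervalIntegrable _ _),
      ← intervalIntegral.integral_const_mul, ← intervalIntegral.integral_const_mul]
    refine intervalIntegral.integral_congr fun θ _ => ?_
    have hcos : Real.cos (n * θ) - Real.cos ((n + 2 : ℕ) * θ) =
        2 * Real.sin θ * Real.sin ((n + 1) * θ) := by
      rw [Real.cos_sub_cos]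
      push_cast
      rw [show ((n : ℝ) * θ + ((n : ℝ) + 2) * θ) / 2 = ((n : ℝ) + 1) * θ by ring,
        show ((n : ℝ) * θ - ((n : ℝ) + 2) * θ) / 2 = -θ by ring, Real.sin_neg]
      ring
    rw [← mul_sub, hcos]
    ring
  rw [integral_mul_sin_mul_sin_mul_exp] at hdiff
  have : π * (x * (besselI n x - besselI (n + 2) x)) = π * (2 * (n + 1) * besselI (n + 1) x) := by
    rw [hdiff]; ring
  exact mul_left_cancel₀ hπ this

/-- The same recurrence in the DLMF form `I_{n}(x) − I_{n+2}(x) = (2(n+1)/x) I_{n+1}(x)` for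
`x ≠ 0`. [cite: DLMF, 10.29.1] -/
theorem besselI_sub_besselI_add_two (n : ℕ) {x : ℝ} (hx : x ≠ 0) :
    besselI n x - besselI (n + 2) x = 2 * (n + 1) / x * besselI (n + 1) x := by
  have h := mul_besselI_sub_besselI_add_two n x
  field_simp
  linarith

end Literature.Analysis.FunctionSpaces
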